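import Summits.QuantumFields.BalabanUV.T4Continuum.Support.NE7NearFlatSharpPrep
import Summits.QuantumFields.BalabanUV.T4Continuum.Support.NE3ClassSixFlatWitness
import HarnessLib

/-!
# NE7NearFlatFromGlobalGauge — THE EXPLICIT «ALMOST FLAT ⇒ NEAR FLAT» LETTER THAT GEN 26's GLOBAL GAUGE DOES GIVE: under the sector condition
# `card n·N²·γ ≤ sectorConst n`, a `γ`-small `U(n)`-valued `N`-periodic datum is bondwise within `e^{a} − 1`, `a = gaugeConst(n)·(N⁻¹ + N·γ)`, of a FLAT
# `U(n)`-valued `N`-periodic datum (relative distance, no gauge) — explicit, LINEAR in `γ` above the holonomy floor `N⁻¹`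

Cell `pub-balaban`, rung (B)+1 sub-cell t4, lineage `b2b-balaban-t4-ne7b-p1` (row NE7b OWNER + CRUX PROVER), generation 157; junction census for the NE7 road's
located gap (G2) of `t4/b2b-balaban-t4-ne7-p1-g113/ROAD-G113.md` §6 next (ii) («explicit γ = c(n)ε′∕N via gen 26's `TorusSmallFieldGlobalGauge`»).  The positive
half of the census (parts 2–4 `NE7NearFlatSharp{Abelian,Holonomy,Sector}` are the negative half): what (ii) CAN deliver, and exactly where it stops — the holonomy
floor `N⁻¹` (gen 26 gauges to the TRIVIAL flat orbit), so the letter is usable only for tori with `gaugeConst(n)∕N` below the target radius; below that size parts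
3∕4 show the near-flat threshold is quadratic in the target radius and `< 2π∕N²` along paths.
WHAT ([folklore]; 0 def, 0 sorry).  `flat_pureGauge_letters` (the pure gauge `F = 1^{u⁻¹}` of a unitary `N`-periodic site field is `U(n)`-valued, `N`-periodic, flat);
**`exists_flat_near_explicit`** — for `N ≥ 1`, `0 ≤ γ`, `card n·N²·γ ≤ sectorConst n`, every `U(n)`-valued `N`-periodic `V` with `SmallField V γ` has a `U(n)`-valued
`N`-periodic `F` with all plaquette variables `1` and `‖F(b)⁻¹V(b) − 1‖ ≤ exp(gaugeConst n·(N⁻¹ + N·γ)) − 1` at every bond (F29 `exists_flat_near`'s conclusion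
with an EXPLICIT radius; `TorusSmallFieldGlobalGauge.torusSmallFieldGlobalGauge_explicit` + `F := (u⁻¹)`-pure gauge + `‖e^A − 1‖ ≤ e^{‖A‖} − 1`);
`exists_flat_near_explicit_of_le` — the same packaged as «`γ`-small ⇒ `ε′`-near flat» whenever `exp(gaugeConst n·(N⁻¹ + N·γ)) − 1 ≤ ε′`.
HONEST FRAMING (page 1): a repackaging of gen 26's letter; the bound does NOT tend to `0` with `γ` at fixed `N` (holonomy floor) — consistent with parts 2–4; F29,
the road's ENDs and `hsector` untouched; nothing of Bałaban's asserted; NE3∕NE7 NOT proved; row NE7b (`T4WeightBudget.RelWeightBound`) NOT PRINTED ∕ NOT PROVED;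
spine count = dagwriter's call; finite T⁴ rung (B)+1 — NOT infinite volume, NOT mass gap, NOT BetaPertH, NOT Clay (continuum YM on T⁴ ⇐ BetaPertH ∧ nine spine
estimates).
-/

set_option autoImplicit false

open scoped BigOperators Matrix Matrix.Norms.L2Operator
open Finset NormedSpace Complex

namespace Summit.QuantumFields.BalabanUV.T4Continuum.NE7NearFlatFromGlobalGauge

open Literature.MathematicalPhysics.QuantumFieldTheory.Balaban1983to89
open B7Prop1Explicit B7Prop2Explicit
open T4AveragingDeficitWall hiding Site Plane Plaq Bond
open T4AveragingDeficitWallBoundary (IsPeriodicCfg)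
open NE3EnergyShapes (IsUnitarySite IsPeriodicSite)
open MinimalActionWitness (flatCfg)
open TorusSmallFieldGlobalGauge (sectorConst gaugeConst torusSmallFieldGlobalGauge_explicit)
open NE3ClassSixFlatWitness (hol_gaugeAct_flatCfg_plaqWord)
open AveragingDeficitKDatum (isUnitaryCfg_gaugeAct)

noncomputable section

variable {n : Type*} [Fintype n] [DecidableEq n]

/-- THE PURE GAUGE `F(x, κ) = u(x)⁻¹ u(x + e_κ)` of a unitary `N`-periodic site field is `U(n)`-valued, `N`-periodic and flat. [folklore] -/
theorem flat_pureGauge_letters {N : ℕ} {u : Site 4 → (Matrix n n ℂ)ˣ} (hu : IsUnitarySite u) (huP : IsPeriodicSite u (N : ℤ)) :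
    IsUnitaryCfg (gaugeAct (fun x => (u x)⁻¹) (flatCfg : Site 4 → Fin 4 → (Matrix n n ℂ)ˣ)) ∧
    IsPeriodicCfg (gaugeAct (fun x => (u x)⁻¹) (flatCfg : Site 4 → Fin 4 → (Matrix n n ℂ)ˣ)) (N : ℤ) ∧
    ∀ (x : Site 4) (κ μ : Fin 4), κ ≠ μ → hol (gaugeAct (fun x => (u x)⁻¹) (flatCfg : Site 4 → Fin 4 → (Matrix n n ℂ)ˣ)) x (plaqWord κ μ) = 1 := by
  refine ⟨isUnitaryCfg_gaugeAct (fun z => (unitaryUnits _).inv_mem (hu z)) (fun _ _ => (unitaryUnits _).one_mem), fun x κ μ => ?_,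
    fun x κ μ _ => hol_gaugeAct_flatCfg_plaqWord _ x κ μ⟩
  simp only [gaugeAct, flatCfg]
  rw [add_right_comm, huP, huP]

/-- **THE EXPLICIT NEAR-FLAT LETTER FROM GEN 26's GLOBAL GAUGE.**  For `N ≥ 1`, `0 ≤ γ` with `card n·N²·γ ≤ sectorConst n`, every `U(n)`-valued `N`-periodic
`V` with `SmallField V γ` admits a `U(n)`-valued `N`-periodic `F` with all plaquette variables `1` such that at every bond
`‖F(b)⁻¹V(b) − 1‖ ≤ exp(gaugeConst n·(N⁻¹ + N·γ)) − 1`.  Proof: gen 26 gives a unitary `N`-periodic `u` and `A` with `V^u = exp A`, `‖A‖ ≤ a`; put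
`F = 1^{u⁻¹}`, i.e. `F(x, κ) = u(x)⁻¹ u(x + e_κ)`; then `F(b)⁻¹V(b) = u(x+e_κ)⁻¹ (exp A(b)) u(x+e_κ)` and unitary conjugation is isometric on `‖· − 1‖`.
[folklore] -/
theorem exists_flat_near_explicit [Nonempty n] {N : ℕ} (hN : 1 ≤ N) {γ : ℝ} (hγ : 0 ≤ γ)
    (hsec : (Fintype.card n : ℝ) * (N : ℝ) ^ 2 * γ ≤ sectorConst n) {V : Site 4 → Fin 4 → (Matrix n n ℂ)ˣ} (hVu : IsUnitaryCfg V)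
    (hVP : IsPeriodicCfg V (N : ℤ)) (hVs : SmallField V γ) :
    ∃ F : Site 4 → Fin 4 → (Matrix n n ℂ)ˣ, IsUnitaryCfg F ∧ IsPeriodicCfg F (N : ℤ) ∧
      (∀ (x : Site 4) (κ μ : Fin 4), κ ≠ μ → hol F x (plaqWord κ μ) = 1) ∧
      ∀ (x : Site 4) (κ : Fin 4), ‖(((F x κ)⁻¹ : (Matrix n n ℂ)ˣ) : Matrix n n ℂ) * (V x κ : Matrix n n ℂ) - 1‖
        ≤ Real.exp (gaugeConst n * (((N : ℝ))⁻¹ + (N : ℝ) * γ)) - 1 := by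
  obtain ⟨u, hu, huP, A, hA⟩ := torusSmallFieldGlobalGauge_explicit hN hγ hsec hVu hVP hVs
  obtain ⟨hFu, hFP, hFflat⟩ := flat_pureGauge_letters (n := n) hu huP
  refine ⟨_, hFu, hFP, hFflat, fun x κ => ?_⟩
  obtain ⟨hexp, hnorm⟩ := hA x κ
  -- `F(b)⁻¹ V(b) = u(x+e_κ)⁻¹ · V^u(b) · u(x+e_κ)`
  have hV : V x κ = (u x)⁻¹ * gaugeAct u V x κ * u (x + e κ) := by simp only [gaugeAct]; group
  have e1 : (gaugeAct (fun x => (u x)⁻¹) (flatCfg : Site 4 → Fin 4 → (Matrix n n ℂ)ˣ) x κ)⁻¹ * V x κ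
      = (u (x + e κ))⁻¹ * gaugeAct u V x κ * u (x + e κ) := by
    rw [hV]; simp only [gaugeAct, flatCfg]; group
  rw [← Units.val_mul, e1, Units.val_mul, Units.val_mul, hexp]
  have hconj := norm_units_inv_conj_sub_one_le (NE7NearFlatSharpPrep.mem_U1_of_mem_unitaryUnits (hu (x + e κ))) (exp (A x κ))
  exact hconj.trans (norm_exp_sub_one_le_of_norm_le hnorm).1

/-- **PACKAGED AS F29's CONCLUSION WITH AN EXPLICIT THRESHOLD**: if `exp(gaugeConst n·(N⁻¹ + N·γ)) − 1 ≤ ε′` (which forces `N ≳ gaugeConst n∕ε′` — the holonomy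
floor — and then allows `γ` up to `≍ ε′∕(gaugeConst n·N)`, LINEAR in `ε′`), then every `γ`-small `U(n)`-valued `N`-periodic `V` in the sector
`card n·N²·γ ≤ sectorConst n` is within `ε′` (relative, bondwise, no gauge) of a flat `U(n)`-valued `N`-periodic datum. [folklore] -/
theorem exists_flat_near_explicit_of_le [Nonempty n] {N : ℕ} (hN : 1 ≤ N) {γ ε' : ℝ} (hγ : 0 ≤ γ)
    (hsec : (Fintype.card n : ℝ) * (N : ℝ) ^ 2 * γ ≤ sectorConst n) (hε' : Real.exp (gaugeConst n * (((N : ℝ))⁻¹ + (N : ℝ) * γ)) - 1 ≤ ε')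
    {V : Site 4 → Fin 4 → (Matrix n n ℂ)ˣ} (hVu : IsUnitaryCfg V) (hVP : IsPeriodicCfg V (N : ℤ)) (hVs : SmallField V γ) :
    ∃ F : Site 4 → Fin 4 → (Matrix n n ℂ)ˣ, IsUnitaryCfg F ∧ IsPeriodicCfg F (N : ℤ) ∧
      (∀ (x : Site 4) (κ μ : Fin 4), κ ≠ μ → hol F x (plaqWord κ μ) = 1) ∧
      ∀ (x : Site 4) (κ : Fin 4), ‖(((F x κ)⁻¹ : (Matrix n n ℂ)ˣ) : Matrix n n ℂ) * (V x κ : Matrix n n ℂ) - 1‖ ≤ ε' := by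
  obtain ⟨F, hFu, hFP, hflat, hnear⟩ := exists_flat_near_explicit hN hγ hsec hVu hVP hVs
  exact ⟨F, hFu, hFP, hflat, fun x κ => (hnear x κ).trans hε'⟩

end

end Summit.QuantumFields.BalabanUV.T4Continuum.NE7NearFlatFromGlobalGauge
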